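import Literature.AlgebraicGeometry.Deformation.FlatDeformationTransitionData
import HarnessLib

/-!
# The transition data of a flat deformation, for a given principal affine cover downstairs
# (Hartshorne, *Deformation Theory*, proof of Thm. 10.2 (a))

Layer `Literature/AlgebraicGeometry/Deformation` (THEOREMS only); the consumer form of (c2b)
★ `FlatDeformationTransitionData.exists_transition_data` for the F3c dictionary (cell `hodgecm-mathlib`, F-11 (A3)):
the same statement for a GIVEN affine cover `U : ι → X.affineOpens` of the closed fibre with `U j = i⁻¹(U' j)`
(`hU`, e.g. the road (β) lift of ★ `Morphisms/NilpotentThickeningCoverLift`) instead of the derived cover `i⁻¹(U' j)`,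
and with the closed-fibre compatibility of the charts written through `i.appLE (U' j) (U j)` — the binder block of
(c2c) `FlatDeformationGluedIso` and of the glue datum ★ `deformationGlueDatum` (`R := A`, `U`, `b j l := i♯ b'_{jl}|`).

* `exists_transition_data_of_cover` — `∃ e ε₁ ε₂` with the chart/restriction/closed-fibre equations, admissibility and
  the cocycle clause for `ψ j l := transition (ε₁ j l) (ε₂ j l)`, all typed on `(U j).1 ⊓ (U l).1 [⊓ (U m).1]`.

HC_CM is proved only modulo the 7 printed citations until rung 0 closes — nothing here bears on a summit statement.

## References
* [Hartshorne2010] R. Hartshorne, *Deformation Theory*, GTM 257, Springer (2010): Thm. 10.2 (a) and its proof (p. 81).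
-/

noncomputable section

-- `TopCat.Presheaf`/`TopCat.Sheaf` are not reducible (as in Mathlib's `AlgebraicGeometry/Modules`).
set_option backward.isDefEq.respectTransparency false

open CategoryTheory AlgebraicGeometry Opposite TopologicalSpace Limits
open scoped TensorProduct

universe u

namespace Literature.AlgebraicGeometry.Deformation

open Literature.AlgebraicGeometry.Motives Literature.AlgebraicGeometry.Morphisms SmoothAffineDeformation

variable {k : Type u} [Field k] {A : Type u} [CommRing A] [Algebra k A] (π : A →ₐ[k] k)
  {X : Over (Spec (CommRingCat.of k))} [instΓ : ∀ W : X.left.Opens, Algebra k Γ(X.left, W)]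
  (halg : ∀ (W : X.left.Opens) (s : k), algebraMap k Γ(X.left, W) s = (constToPresheaf X).app (op W) s)
  {Y : Over (Spec (CommRingCat.of A))} [instΓA : ∀ W : Y.left.Opens, Algebra A Γ(Y.left, W)]
  (halgA : ∀ (W : Y.left.Opens) (a : A), algebraMap A Γ(Y.left, W) a = (constToPresheaf Y).app (op W) a)
  (i : X.left ⟶ Y.left) (hi : IsPullback i X.hom Y.hom (Spec.map (CommRingCat.ofHom π.toRingHom)))

include hi halg halgA in
/-- **The transition data of a flat deformation on a given principal affine cover** (★ `exists_transition_data` for a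
cover `U` of the closed fibre with `U j = i⁻¹(U' j)`): chart trivialisations `e j : A ⊗_k Γ(X, U j) ≃ₐ[A] Γ(Y, U' j)`
over the closed fibres, their overlap restrictions `ε₁ j l` (of `e j`) and `ε₂ j l` (of `e l`), with
`ψ j l := transition (ε₁ j l) (ε₂ j l)` admissible and cocycle-exact in the `∀`-form of the glue datum.
[cite: Hartshorne2010, Thm. 10.2 (proof), p. 81] -/
theorem exists_transition_data_of_cover [IsArtinianRing A] [IsLocalRing A] [Smooth X.hom] [Flat Y.hom]
    {ι : Type u} (U' : ι → Y.left.affineOpens) (b' : (j l : ι) → Γ(Y.left, (U' j).1))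
    (hb' : ∀ j l, (U' j).1 ⊓ (U' l).1 = Y.left.basicOpen (b' j l))
    (U : ι → X.left.affineOpens) (hU : ∀ j, (U j).1 = i ⁻¹ᵁ (U' j).1) :
    ∃ (e : ∀ j, A ⊗[k] Γ(X.left, (U j).1) ≃ₐ[A] Γ(Y.left, (U' j).1))
      (ε₁ ε₂ : ∀ j l, A ⊗[k] Γ(X.left, (U j).1 ⊓ (U l).1) ≃ₐ[A] Γ(Y.left, (U' j).1 ⊓ (U' l).1)),
      (∀ j x, i.appLE (U' j).1 (U j).1 (hU j).le (e j x) = specialFibreHom π _ x) ∧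
      (∀ j l (a : A) (s : Γ(X.left, (U j).1)),
        ε₁ j l (a ⊗ₜ X.left.presheaf.map (homOfLE inf_le_left).op s) =
          Y.left.presheaf.map (homOfLE inf_le_left).op (e j (a ⊗ₜ s))) ∧
      (∀ j l (a : A) (s : Γ(X.left, (U l).1)),
        ε₂ j l (a ⊗ₜ X.left.presheaf.map (homOfLE inf_le_right).op s) =
          Y.left.presheaf.map (homOfLE inf_le_right).op (e l (a ⊗ₜ s))) ∧
      (∀ j l y, i.appLE ((U' j).1 ⊓ (U' l).1) ((U j).1 ⊓ (U l).1)
          (by rw [hU, hU]; exact (i.preimage_inf).ge) (ε₁ j l y) = specialFibreHom π _ y) ∧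
      (∀ j l y, i.appLE ((U' j).1 ⊓ (U' l).1) ((U j).1 ⊓ (U l).1)
          (by rw [hU, hU]; exact (i.preimage_inf).ge) (ε₂ j l y) = specialFibreHom π _ y) ∧
      (∀ j l x, transition (ε₁ j l) (ε₂ j l) x - x ∈
        (RingHom.ker π) • (⊤ : Submodule A (A ⊗[k] Γ(X.left, (U j).1 ⊓ (U l).1)))) ∧
      (∀ (j l m : ι)
        (Φjl : A ⊗[k] Γ(X.left, (U j).1 ⊓ (U l).1) →ₐ[A] A ⊗[k] Γ(X.left, (U j).1 ⊓ (U l).1 ⊓ (U m).1))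
        (_ : ∀ a s, Φjl (a ⊗ₜ s) = a ⊗ₜ X.left.presheaf.map (homOfLE inf_le_left).op s)
        (Φlm : A ⊗[k] Γ(X.left, (U l).1 ⊓ (U m).1) →ₐ[A] A ⊗[k] Γ(X.left, (U j).1 ⊓ (U l).1 ⊓ (U m).1))
        (_ : ∀ a s, Φlm (a ⊗ₜ s) = a ⊗ₜ X.left.presheaf.map
          (homOfLE (le_inf (inf_le_left.trans inf_le_right) inf_le_right)).op s)
        (Φjm : A ⊗[k] Γ(X.left, (U j).1 ⊓ (U m).1) →ₐ[A] A ⊗[k] Γ(X.left, (U j).1 ⊓ (U l).1 ⊓ (U m).1))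
        (_ : ∀ a s, Φjm (a ⊗ₜ s) = a ⊗ₜ X.left.presheaf.map
          (homOfLE (le_inf (inf_le_left.trans inf_le_left) inf_le_right)).op s)
        (ρjl ρlm ρjm : A ⊗[k] Γ(X.left, (U j).1 ⊓ (U l).1 ⊓ (U m).1) ≃ₐ[A]
          A ⊗[k] Γ(X.left, (U j).1 ⊓ (U l).1 ⊓ (U m).1)),
        (∀ x, ρjl (Φjl x) = Φjl (transition (ε₁ j l) (ε₂ j l) x)) →
        (∀ x, ρlm (Φlm x) = Φlm (transition (ε₁ l m) (ε₂ l m) x)) →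
        (∀ x, ρjm (Φjm x) = Φjm (transition (ε₁ j m) (ε₂ j m) x)) → ρlm * ρjl = ρjm) := by
  -- the cover downstairs IS the derived one
  obtain rfl : U = fun j => ⟨i ⁻¹ᵁ (U' j).1, isAffineOpen_preimage_closedFibre π i hi (U' j).2⟩ :=
    funext fun j => Subtype.ext (hU j)
  obtain ⟨e, ε₁, ε₂, he, hε₁, hε₂, hε₁', hε₂', hψ, hcoc⟩ := exists_transition_data π halg halgA i hi U' b' hb'
  refine ⟨e, ε₁, ε₂, fun j x => ?_, hε₁, hε₂, hε₁', hε₂', hψ, hcoc⟩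
  change i.appLE (U' j).1 (i ⁻¹ᵁ (U' j).1) le_rfl (e j x) = _
  rw [Scheme.Hom.appLE_eq_app]
  exact he j x

end Literature.AlgebraicGeometry.Deformation

end
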